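import Literature.NumberTheory.Automorphic.HidaLevelOrdinaryRestriction
import Literature.NumberTheory.Automorphic.OrdinaryPartOfFiniteModuleProd
import HarnessLib

/-!
# Hida's lemma along the Iwahori depth, any coefficients: `res` is a bijection of the `U_p`-ordinary parts

Topic `NumberTheory/Automorphic`; namespace `Literature.NumberTheory.Automorphic.BigHeckeGLn.TameLevel`;
definitions with bodies and theorems (no named fact, no `sorry`).

`GL₂` over a number field `K`, tame level `U` maximal above `p`, an ARBITRARY coefficient system
`τ : Δ → End V` of the coefficients-at-`p` model on a Hecke monoid `Δ` containing the mixed-depth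
levels `U(b, c_•) = depthLevel b c_•` and the `t_{v,1}`, `v ∣ p` (e.g. `τ = ⨂_τ Sym^{k−2}` on the
integral monoid).  For `1 ≤ r'`, `b ≤ r' ≤ c`, GIVEN finiteness of the cohomology groups
`H^i(U(b, c_•), τ)` and the commutativity of the `U_{v,1}` on them (hypotheses `hfin`, `hcomm`), the
restriction

  `res : H^i(U(b,r'), τ) → H^i(U(b,c), τ)`

is a **bijection of the `U_p`-ordinary parts `⋂_{v ∣ p} ⋂ₘ range U_{v,1}^m`**
(`bijOn_resCohomology_ordAtΔ`): both halves of Hida's lemma ([Hida1994AIF, §2–3];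
[KhareThorne2017, §6.3, Lemma 6.10]), extending `HidaLevelOrdinaryRestriction` (trivial
coefficients, injectivity only).

Proof: one place and one step of depth at a time; at the step `v₀` the abstract Hida lemma
`bijOn_of_comp_eq` is run with the operator `[U t_{v₀} U'] ∘ ∏_{v ≠ v₀} U_{v,1}` (conditions `C₁`,
`C₂` of [KhareThorne2017, Lemma 6.10] at `v₀`, equivariance of `res` at the other places), whose
composites with `res` are the products `∏_v U_{v,1}` at the two levels; the joint ordinary part is the
ordinary part of that product (`iInf_range_pow_noncommProd_eq`).

## References

* H. Hida, Ann. Inst. Fourier 44 (1994), §2–3 (held). [Hida1994AIF]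
* C. Khare, J. A. Thorne, Amer. J. Math. 139 (2017), §6.3, Lemma 6.10 (arXiv:1409.7007, held). [KhareThorne2017]
-/

noncomputable section

open CategoryTheory IsDedekindDomain
open scoped NumberField Classical

namespace Literature.NumberTheory.Automorphic

/-! ### Generic: intertwining finite commuting products -/

/-- A linear map intertwining two commuting families intertwines their `noncommProd`s. [folklore] -/
theorem comp_noncommProd_eq_of_forall {R : Type*} [Semiring R] {M N : Type*} [AddCommMonoid M] [AddCommMonoid N]
    [Module R M] [Module R N] {ι' : Type*} (f : M →ₗ[R] N) (s : Finset ι')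
    (T : ι' → Module.End R M) (T' : ι' → Module.End R N)
    (hT : (s : Set ι').Pairwise fun a b => Commute (T a) (T b))
    (hT' : (s : Set ι').Pairwise fun a b => Commute (T' a) (T' b))
    (h : ∀ i ∈ s, f ∘ₗ T i = T' i ∘ₗ f) :
    f ∘ₗ s.noncommProd T hT = s.noncommProd T' hT' ∘ₗ f := by
  induction s using Finset.induction_on with
  | empty =>
    rw [Finset.noncommProd_empty, Finset.noncommProd_empty]
    rfl
  | insert a s ha ih =>
    rw [Finset.noncommProd_insert_of_notMem _ _ _ _ ha, Finset.noncommProd_insert_of_notMem _ _ _ _ ha,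
      Module.End.mul_eq_comp, Module.End.mul_eq_comp, ← LinearMap.comp_assoc, h a (Finset.mem_insert_self a s),
      LinearMap.comp_assoc,
      ih (hT.mono fun _ h => Finset.mem_insert_of_mem h) (hT'.mono fun _ h => Finset.mem_insert_of_mem h)
        (fun i hi => h i (Finset.mem_insert_of_mem hi)),
      LinearMap.comp_assoc]

/-- `⨅_{v ∈ univ} = ⨅_v`. [folklore] -/
theorem iInf_mem_univ_eq {α β : Type*} [Fintype α] [CompleteLattice β] (f : α → β) :
    (⨅ a ∈ (Finset.univ : Finset α), f a) = ⨅ a, f a :=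
  le_antisymm (le_iInf fun a => iInf₂_le a (Finset.mem_univ a)) (le_iInf₂ fun a _ => iInf_le f a)

namespace BigHeckeGLn

namespace TameLevel

open LevelAction

variable {K : Type} [Field K] [NumberField K] {p : ℕ} [Fact p.Prime] (𝒰 : TameLevel 2 K p)
  {R : Type} [CommRing R] {Γ : Type} [Group Γ] (ι : Γ →* FiniteAdelicGL 2 K)
  (Δ : Submonoid (FiniteAdelicGL 2 K)) {V : Type} [AddCommGroup V] [Module R V] (τ : Δ →* Module.End R V)
  (hΔ : ∀ v : PlacesAbove K p, heckeElement 2 K v.1 1 ∈ Δ)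

/-! ### The joint ordinary part for an arbitrary coefficient system -/

/-- **`Ord(U) = ⋂_{v ∣ p} ⋂ₘ U_{v,1}^m H^i(U, τ)`** at a level `U ⊆ Δ`. [cite: KhareThorne2017, §2.4, Lemma 2.10] -/
def ordAtΔ {U : Subgroup (FiniteAdelicGL 2 K)} (hU : U.toSubmonoid ≤ Δ) (i : ℕ) :
    Submodule R (cohomology ι Δ τ U i) :=
  ⨅ (v : PlacesAbove K p) (m : ℕ), LinearMap.range (heckeCohomology ι Δ τ U hU (hΔ v) i ^ m)

variable {𝒰 ι Δ τ hΔ}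

/-- The product operator `∏_v U_{v,1}` and the joint ordinary part: `Ord(U) = ⋂ₘ range (∏_v U_{v,1})^m`
(commuting `U_{v,1}`, finite cohomology). [cite: KhareThorne2017, §2.4, Lemma 2.10] -/
theorem ordAtΔ_eq_iInf_range_pow_noncommProd {U : Subgroup (FiniteAdelicGL 2 K)} (hU : U.toSubmonoid ≤ Δ) (i : ℕ)
    (hc : ∀ v w : PlacesAbove K p, Commute (heckeCohomology ι Δ τ U hU (hΔ v) i) (heckeCohomology ι Δ τ U hU (hΔ w) i))
    [Finite (cohomology ι Δ τ U i)] :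
    ordAtΔ ι Δ τ hΔ hU i =
      ⨅ m : ℕ, LinearMap.range ((Finset.univ : Finset (PlacesAbove K p)).noncommProd
        (fun v => heckeCohomology ι Δ τ U hU (hΔ v) i) (fun v _ w _ _ => hc v w) ^ m) := by
  rw [iInf_range_pow_noncommProd_eq, iInf_mem_univ_eq]
  rfl

/-! ### One step of Iwahori depth -/

section Step

variable (h𝒰 : 𝒰.IsMaximalAbove) {b : ℕ}
  (hUΔ : ∀ cv : PlacesAbove K p → ℕ, (𝒰.depthLevel b cv).toSubmonoid ≤ Δ)
  (hfin : ∀ (cv : PlacesAbove K p → ℕ) (i : ℕ), Finite (cohomology ι Δ τ (𝒰.depthLevel b cv) i))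
  (hcomm : ∀ (cv : PlacesAbove K p → ℕ) (i : ℕ) (v w : PlacesAbove K p),
    Commute (heckeCohomology ι Δ τ (𝒰.depthLevel b cv) (hUΔ cv) (hΔ v) i)
      (heckeCohomology ι Δ τ (𝒰.depthLevel b cv) (hUΔ cv) (hΔ w) i))

include h𝒰 in
/-- `res : H^i(U(b, c_•)) → H^i(U(b, c'_•))` (`c_• ≤ c'_•`, all `cv v ≥ 1` or `b ≥ 1`) intertwines every
`U_{v,1}`. [cite: KhareThorne2017, §6.2, Lemma 6.5 (2)] -/
theorem resCohomology_comp_heckeCohomology_depthLevel {cv cv' : PlacesAbove K p → ℕ} (h : ∀ v, cv v ≤ cv' v)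
    (h1 : ∀ v, 1 ≤ max b (cv v)) (i : ℕ) (v : PlacesAbove K p) :
    (resCohomology ι Δ τ (𝒰.depthLevel_anti b h) i).hom ∘ₗ heckeCohomology ι Δ τ (𝒰.depthLevel b cv) (hUΔ cv) (hΔ v) i =
      heckeCohomology ι Δ τ (𝒰.depthLevel b cv') (hUΔ cv') (hΔ v) i ∘ₗ (resCohomology ι Δ τ (𝒰.depthLevel_anti b h) i).hom := by
  have hc := congrArg ModuleCat.Hom.hom (resCohomology_heckeCohomology_of_bijOn ι Δ τ (hUΔ cv) (hUΔ cv')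
    (𝒰.depthLevel_anti b h : 𝒰.depthLevel b cv' ≤ 𝒰.depthLevel b cv) (hΔ v)
    (𝒰.bijOn_levelAt_heckeElement_of_mem h𝒰 (fun w => iwahoriLevel_antitone w.1 le_rfl (h w)) v.2 (h1 v) rfl rfl 1) i)
  rw [ModuleCat.hom_comp, ModuleCat.hom_comp] at hc
  exact hc.symm

include h𝒰 hfin hcomm in
/-- **One step of Hida's lemma, both halves**: `res : H^i(U(b, c_•)) → H^i(U(b, c_• + δ_{v₀}))` is a
bijection of the joint ordinary parts (`1 ≤ c_v` for all `v`, `b ≤ c_{v₀} + 1`).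
[cite: KhareThorne2017, §6.3, Lemma 6.10] [cite: Hida1994AIF, §2] -/
theorem bijOn_resCohomology_ordAtΔ_update (cv : PlacesAbove K p → ℕ) (v₀ : PlacesAbove K p)
    (hc1 : ∀ v, 1 ≤ cv v) (hbc : b ≤ cv v₀ + 1) (i : ℕ)
    (hle : 𝒰.depthLevel b (Function.update cv v₀ (cv v₀ + 1)) ≤ 𝒰.depthLevel b cv) :
    Set.BijOn (resCohomology ι Δ τ hle i).hom
      (ordAtΔ ι Δ τ hΔ (hUΔ cv) i) (ordAtΔ ι Δ τ hΔ (hUΔ (Function.update cv v₀ (cv v₀ + 1))) i) := by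
  classical
  set cv' := Function.update cv v₀ (cv v₀ + 1) with hcv'
  haveI := hfin cv i
  haveI := hfin cv' i
  have hmono : ∀ v, cv v ≤ cv' v := fun v => by
    by_cases hv : v = v₀
    · subst hv; rw [hcv', Function.update_self]; exact Nat.le_succ _
    · rw [hcv', Function.update_of_ne hv]
  have hle' : 𝒰.depthLevel b cv' ≤ 𝒰.depthLevel b cv := 𝒰.depthLevel_anti b hmono
  -- the data of the abstract Hida lemma
  have hΛ'v : (fun w : PlacesAbove K p => iwahoriLevel 2 w.1 b (cv' w)) ⟨v₀.1, v₀.2⟩ = iwahoriLevel 2 v₀.1 b (cv v₀ + 1) := by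
    simp only [Subtype.coe_eta, hcv', Function.update_self]
  have hΛ' : ∀ w : PlacesAbove K p, w.1 ≠ v₀.1 →
      (fun w : PlacesAbove K p => iwahoriLevel 2 w.1 b (cv' w)) w = (fun w : PlacesAbove K p => iwahoriLevel 2 w.1 b (cv w)) w :=
    fun w hw => by simp only [hcv', Function.update_of_ne (fun h => hw (congrArg Subtype.val h))]
  have hC₁ := 𝒰.exists_levelAt_coset_eq v₀.2 (b := b) (c := cv v₀)
    (Λ := fun w : PlacesAbove K p => iwahoriLevel 2 w.1 b (cv w))
    (Λ' := fun w : PlacesAbove K p => iwahoriLevel 2 w.1 b (cv' w)) rfl hΛ'v hΛ' h𝒰 (hc1 v₀) hbc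
  have hC₂ := 𝒰.levelAt_coset_eq_of_conj_mem v₀.2 (b := b) (c := cv v₀)
    (Λ := fun w : PlacesAbove K p => iwahoriLevel 2 w.1 b (cv w))
    (Λ' := fun w : PlacesAbove K p => iwahoriLevel 2 w.1 b (cv' w)) rfl hΛ'v hΛ' hbc
  -- names
  set res := (resCohomology ι Δ τ hle i).hom with hres
  set Θ := (heckeCohomology₂ ι Δ τ (hUΔ cv) (hUΔ cv') (hΔ v₀) i).hom with hΘ
  set TV : PlacesAbove K p → Module.End R (cohomology ι Δ τ (𝒰.depthLevel b cv) i) :=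
    fun v => heckeCohomology ι Δ τ (𝒰.depthLevel b cv) (hUΔ cv) (hΔ v) i with hTV
  set TW : PlacesAbove K p → Module.End R (cohomology ι Δ τ (𝒰.depthLevel b cv') i) :=
    fun v => heckeCohomology ι Δ τ (𝒰.depthLevel b cv') (hUΔ cv') (hΔ v) i with hTW
  have hcV : ∀ v w, Commute (TV v) (TV w) := fun v w => hcomm cv i v w
  have hcW : ∀ v w, Commute (TW v) (TW w) := fun v w => hcomm cv' i v w
  set s := (Finset.univ : Finset (PlacesAbove K p)).erase v₀ with hs
  set PV := s.noncommProd TV (fun v _ w _ _ => hcV v w) with hPV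
  set PW := s.noncommProd TW (fun v _ w _ _ => hcW v w) with hPW
  -- `res ∘ T_v = T_v ∘ res` for every `v`, hence `res ∘ PV = PW ∘ res`
  have hresT : ∀ v, res ∘ₗ TV v = TW v ∘ₗ res := fun v =>
    𝒰.resCohomology_comp_heckeCohomology_depthLevel h𝒰 hUΔ hmono (fun v => le_max_of_le_right (hc1 v)) i v
  have hresP : res ∘ₗ PV = PW ∘ₗ res :=
    comp_noncommProd_eq_of_forall res s TV TW _ _ fun v _ => hresT v
  -- `C₂`: `Θ ∘ res = T_{v₀}` upstairs; `C₁`: `res ∘ Θ = T_{v₀}` downstairs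
  have h₁ : Θ ∘ₗ res = TV v₀ := by
    have h := congrArg ModuleCat.Hom.hom (resCohomology_comp_heckeCohomology₂_of_C₂ ι Δ τ (hUΔ cv) (hUΔ cv') hle (hΔ v₀) hC₂ i)
    rw [ModuleCat.hom_comp] at h
    exact h
  have h₂ : res ∘ₗ Θ = TW v₀ := by
    have h := congrArg ModuleCat.Hom.hom (heckeCohomology₂_comp_resCohomology_of_C₁ ι Δ τ (hUΔ cv) (hUΔ cv') hle (hΔ v₀) hC₁ i)
    rw [ModuleCat.hom_comp] at h
    exact h
  -- the operator `T = Θ ∘ PW` and its composites with `res`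
  have hT₁ : (Θ ∘ₗ PW) ∘ₗ res = TV v₀ * PV := by
    rw [LinearMap.comp_assoc, ← hresP, ← LinearMap.comp_assoc, h₁, Module.End.mul_eq_comp]
  have hT₂ : res ∘ₗ (Θ ∘ₗ PW) = TW v₀ * PW := by
    rw [← LinearMap.comp_assoc, h₂, Module.End.mul_eq_comp]
  -- the joint ordinary parts are the ordinary parts of the products
  have hordV : ordAtΔ ι Δ τ hΔ (hUΔ cv) i = ⨅ m : ℕ, LinearMap.range ((TV v₀ * PV) ^ m) := by
    have hcomm₀ : Commute (TV v₀) PV := Finset.noncommProd_commute s TV _ _ fun w _ => hcV v₀ w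
    rw [iInf_range_pow_mul_eq hcomm₀, hPV, iInf_range_pow_noncommProd_eq, ordAtΔ, ← iInf_mem_univ_eq,
      ← Finset.insert_erase (Finset.mem_univ v₀), Finset.iInf_insert]
  have hordW : ordAtΔ ι Δ τ hΔ (hUΔ cv') i = ⨅ m : ℕ, LinearMap.range ((TW v₀ * PW) ^ m) := by
    have hcomm₀ : Commute (TW v₀) PW := Finset.noncommProd_commute s TW _ _ fun w _ => hcW v₀ w
    rw [iInf_range_pow_mul_eq hcomm₀, hPW, iInf_range_pow_noncommProd_eq, ordAtΔ, ← iInf_mem_univ_eq,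
      ← Finset.insert_erase (Finset.mem_univ v₀), Finset.iInf_insert]
  rw [hordV, hordW]
  refine bijOn_of_comp_eq hT₁ hT₂ ?_ ?_ (OrdFinite.bijOn_iInf_range_pow _).injOn (OrdFinite.bijOn_iInf_range_pow _).surjOn
  · exact mapsTo_iInf_range_pow_of_comp_eq (comp_eq_comp_of_comp_eq hT₁ hT₂)
  · refine mapsTo_iInf_range_pow_of_comp_eq ?_
    rw [← hT₂, ← LinearMap.comp_assoc, hT₁]

end Step

/-! ### Iterating -/

omit [Fact p.Prime] in
/-- `res` composes (pointwise). [folklore] -/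
theorem resCohomology_hom_comp' {U U' U'' : Subgroup (FiniteAdelicGL 2 K)} (hle : U' ≤ U) (hle' : U'' ≤ U') (i : ℕ)
    (x : cohomology ι Δ τ U i) :
    (resCohomology ι Δ τ (hle'.trans hle) i).hom x =
      (resCohomology ι Δ τ hle' i).hom ((resCohomology ι Δ τ hle i).hom x) := by
  have h : resRepHom ι Δ τ (hle'.trans hle) = resRepHom ι Δ τ hle ≫ resRepHom ι Δ τ hle' := rfl
  dsimp only [resCohomology]
  rw [h, groupCohomology.map_id_comp, ModuleCat.comp_apply]

omit [Fact p.Prime] in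
/-- `res` along `le_rfl` is the identity. [folklore] -/
theorem resCohomology_hom_refl' {U : Subgroup (FiniteAdelicGL 2 K)} (i : ℕ) (x : cohomology ι Δ τ U i) :
    (resCohomology ι Δ τ (le_refl U) i).hom x = x := by
  have h : resRepHom ι Δ τ (le_refl U) = 𝟙 _ := rfl
  dsimp only [resCohomology]
  rw [h, groupCohomology.map_id]
  rfl

variable (𝒰 ι Δ τ hΔ) {b : ℕ} (hUΔ : ∀ cv : PlacesAbove K p → ℕ, (𝒰.depthLevel b cv).toSubmonoid ≤ Δ)

/-- The invariant: `res : H^i(U(b, r')) → H^i(U(b, c_•))` is a bijection of the joint ordinary parts. [folklore] -/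
def ResBij (r' : ℕ) (cv : PlacesAbove K p → ℕ) (i : ℕ) : Prop :=
  ∃ hle : 𝒰.depthLevel b cv ≤ 𝒰.level b r',
    Set.BijOn (resCohomology ι Δ τ hle i).hom
      (ordAtΔ ι Δ τ hΔ (U := 𝒰.level b r') (hUΔ fun _ => r') i : Set (cohomology ι Δ τ (𝒰.level b r') i))
      (ordAtΔ ι Δ τ hΔ (hUΔ cv) i)

variable {𝒰 ι Δ τ hΔ hUΔ}

/-- Base of the induction. [folklore] -/
theorem resBij_const (r' i : ℕ) : 𝒰.ResBij ι Δ τ hΔ hUΔ r' (fun _ => r') i := by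
  change ∃ hle : 𝒰.level b r' ≤ 𝒰.level b r',
    Set.BijOn (resCohomology ι Δ τ hle i).hom
      (ordAtΔ ι Δ τ hΔ (U := 𝒰.level b r') (hUΔ fun _ => r') i : Set (cohomology ι Δ τ (𝒰.level b r') i))
      (ordAtΔ ι Δ τ hΔ (U := 𝒰.level b r') (hUΔ fun _ => r') i : Set (cohomology ι Δ τ (𝒰.level b r') i))
  exact ⟨le_rfl, fun x hx => by rwa [SetLike.mem_coe, resCohomology_hom_refl'], fun x _ y _ h => by
    rwa [resCohomology_hom_refl', resCohomology_hom_refl'] at h, fun x hx => ⟨x, hx, resCohomology_hom_refl' i x⟩⟩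

section Induction

variable (h𝒰 : 𝒰.IsMaximalAbove)
  (hfin : ∀ (cv : PlacesAbove K p → ℕ) (i : ℕ), Finite (cohomology ι Δ τ (𝒰.depthLevel b cv) i))
  (hcomm : ∀ (cv : PlacesAbove K p → ℕ) (i : ℕ) (v w : PlacesAbove K p),
    Commute (heckeCohomology ι Δ τ (𝒰.depthLevel b cv) (hUΔ cv) (hΔ v) i)
      (heckeCohomology ι Δ τ (𝒰.depthLevel b cv) (hUΔ cv) (hΔ w) i))
include h𝒰 hfin hcomm

/-- One step preserves the invariant. [cite: KhareThorne2017, §6.3, Lemma 6.10] -/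
theorem resBij_update {r' : ℕ} (hr' : 1 ≤ r') (hbr' : b ≤ r') {cv : PlacesAbove K p → ℕ}
    (hcv : ∀ v, r' ≤ cv v) (v₀ : PlacesAbove K p) {i : ℕ} (h : 𝒰.ResBij ι Δ τ hΔ hUΔ r' cv i) :
    𝒰.ResBij ι Δ τ hΔ hUΔ r' (Function.update cv v₀ (cv v₀ + 1)) i := by
  classical
  obtain ⟨hle, hbij⟩ := h
  have hmono : ∀ v, cv v ≤ Function.update cv v₀ (cv v₀ + 1) v := fun v => by
    by_cases hv : v = v₀
    · subst hv; rw [Function.update_self]; exact Nat.le_succ _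
    · rw [Function.update_of_ne hv]
  have hle' : 𝒰.depthLevel b (Function.update cv v₀ (cv v₀ + 1)) ≤ 𝒰.depthLevel b cv := 𝒰.depthLevel_anti b hmono
  refine ⟨hle'.trans hle, ?_⟩
  have hfun : ((resCohomology ι Δ τ (hle'.trans hle) i).hom : _ → _) =
      (resCohomology ι Δ τ hle' i).hom ∘ (resCohomology ι Δ τ hle i).hom :=
    funext fun x => resCohomology_hom_comp' hle hle' i x
  rw [hfun]
  exact (𝒰.bijOn_resCohomology_ordAtΔ_update h𝒰 hUΔ hfin hcomm cv v₀ (fun v => hr'.trans (hcv v))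
    (hbr'.trans ((hcv v₀).trans (Nat.le_succ _))) i hle').comp hbij

/-- Raising one place by `n` steps. [folklore] -/
theorem resBij_update_add {r' : ℕ} (hr' : 1 ≤ r') (hbr' : b ≤ r') {cv : PlacesAbove K p → ℕ}
    (hcv : ∀ v, r' ≤ cv v) (v₀ : PlacesAbove K p) {i : ℕ} (h : 𝒰.ResBij ι Δ τ hΔ hUΔ r' cv i) (n : ℕ) :
    𝒰.ResBij ι Δ τ hΔ hUΔ r' (Function.update cv v₀ (cv v₀ + n)) i := by
  induction n with
  | zero => rwa [add_zero, Function.update_eq_self]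
  | succ n ih =>
    have hcv' : ∀ v, r' ≤ Function.update cv v₀ (cv v₀ + n) v := fun v => by
      by_cases hv : v = v₀
      · subst hv; rw [Function.update_self]; exact (hcv v).trans (Nat.le_add_right _ _)
      · rw [Function.update_of_ne hv]; exact hcv v
    have hstep := 𝒰.resBij_update h𝒰 hfin hcomm hr' hbr' hcv' v₀ ih
    rwa [Function.update_idem, Function.update_self, add_assoc] at hstep

/-- Raising a set of places to depth `c`. [folklore] -/
theorem resBij_piecewise {r' c : ℕ} (hr' : 1 ≤ r') (hbr' : b ≤ r') (hc : r' ≤ c) (i : ℕ)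
    (T : Finset (PlacesAbove K p)) :
    𝒰.ResBij ι Δ τ hΔ hUΔ r' (fun v => if v ∈ T then c else r') i := by
  classical
  induction T using Finset.induction_on with
  | empty => simpa using resBij_const (𝒰 := 𝒰) (ι := ι) (Δ := Δ) (τ := τ) (hΔ := hΔ) (hUΔ := hUΔ) r' i
  | @insert v₀ T hv₀ ih =>
    have h := 𝒰.resBij_update_add h𝒰 hfin hcomm hr' hbr' (cv := fun v => if v ∈ T then c else r')
      (fun v => by split_ifs <;> omega) v₀ ih (c - r')
    have heq : Function.update (fun v => if v ∈ T then c else r') v₀ ((if v₀ ∈ T then c else r') + (c - r')) =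
        fun v => if v ∈ insert v₀ T then c else r' := by
      funext v
      by_cases hv : v = v₀
      · subst hv
        rw [Function.update_self, if_neg hv₀, if_pos (Finset.mem_insert_self _ _), Nat.add_sub_cancel' hc]
      · rw [Function.update_of_ne hv]
        simp [Finset.mem_insert, hv]
    rwa [heq] at h

/-- **Hida's lemma along the Iwahori depth, both halves, any coefficients:
`res : H^i(U(b,r'), τ) → H^i(U(b,c), τ)` is a bijection of the `U_p`-ordinary parts** (`1 ≤ r'`,
`b ≤ r' ≤ c`; finite cohomology, commuting `U_{v,1}`). [cite: Hida1994AIF, §2–3] [cite: KhareThorne2017, §6.3, Lemma 6.10] -/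
theorem bijOn_resCohomology_ordAtΔ {r' c : ℕ} (hr' : 1 ≤ r') (hbr' : b ≤ r') (hc : r' ≤ c) (i : ℕ) :
    Set.BijOn (resCohomology ι Δ τ (𝒰.level_antitone le_rfl hc : 𝒰.level b c ≤ 𝒰.level b r') i).hom
      (ordAtΔ ι Δ τ hΔ (U := 𝒰.level b r') (hUΔ fun _ => r') i : Set (cohomology ι Δ τ (𝒰.level b r') i))
      (ordAtΔ ι Δ τ hΔ (U := 𝒰.level b c) (hUΔ fun _ => c) i : Set (cohomology ι Δ τ (𝒰.level b c) i)) := by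
  classical
  have h := 𝒰.resBij_piecewise h𝒰 hfin hcomm hr' hbr' hc i Finset.univ
  simp only [Finset.mem_univ, if_true] at h
  obtain ⟨hle, hbij⟩ := h
  exact hbij

end Induction

end TameLevel

end BigHeckeGLn

end Literature.NumberTheory.Automorphic
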